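import Summits.ValiantsHypothesis.ValiantsHypothesis.Theorems.LacunarySymmetroidMatrixDescartesCensusNewtonCone
import Summits.ValiantsHypothesis.ValiantsHypothesis.Theorems.LacunarySymmetroidMatrixDescartesCensusKappaStar

/-!
# `MatrixDescartes` census — THEOREM L-N (a) in the kernel: CONJECTURE L(d) (and its `s = 0` rungs) on Newton-good windows

HONEST FRAMING.  Object-search cell `pub-symmetroid`, route crux `Theses.LacunarySymmetroid.MatrixDescartes`
(ledger item stmt-ValiantsHypothesis-18050).  ONE theorem, the kernel form of part (a) of engine-1 g14's
**THEOREM L-N** (memo `HOME/engine-1/g14/l18n/THEOREM-LN-E1G14.md` §2(a); READER PASS theory-2 g14, bus R922):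

`newton_s0_window`: let `f = Σ_{t<n} c_t X^{e_t}` (`n ≥ 6`, `e` strictly increasing, all `c_t ≠ 0`) have at
least `n − 1` distinct positive roots (Descartes-sharp), and let the first five gaps have the class-G shape
`e₁ − e₀ = (e₂ − e₁) + (e₃ − e₂)` and `e₄ − e₃ = e₂ − e₁` (for the door-B window `E = (0, d₁, d₂, 2d₁, d₁+d₂, 2d₂, …)`:
gaps `d₁, δ, d₁ − δ, δ` with `δ = d₂ − d₁`).  With `π_t := ∏_{u≠t}|e_t − e_u|`, `u_t := |c_t|`: if
`π₀π₂π₃π₄ + π₁π₂²π₃ ≤ π₀π₁π₄²` («`M_W(d) ≥ 0`», a support-only condition) then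
`Φ := 4u₀u₃u₅ + u₁²u₅ + u₂²u₃ − u₀u₄² − u₁u₂u₄ > 0`.
For the full 15-knot window of a class-G Sidon support this is the cell's CONJECTURE L(d) — hence «door B EMPTY on d»
in the cell's dictionary (DOORB-GRAM R1) — on every «Newton-good» support (`M_W(d) ≥ 0`: 29 591 of the 44 555 class-G
Sidon supports `d₄ ≤ 60`, entire census families; engine-1 g14's scope tables), BY PROOF.
PROOF (the memo's argument without the WLOG scaling): the tree's Newton cone `Census.newton_cone_log` (C25) at the
consecutive triples `(0,1,2)`, `(1,2,3)`, `(2,3,4)` gives three linear inequalities in `L_t = log(u_tπ_t)`; two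
nonnegative combinations of them are `L₁ + L₄ ≤ L₂ + L₃` and `L₀ + 2L₄ ≤ 2L₂ + L₃`, i.e. `u₁u₄π₁π₄ ≤ u₂u₃π₂π₃` and
`u₀u₄²π₀π₄² ≤ u₂²u₃π₂²π₃`; with `M_W ≥ 0` these give `u₁u₂u₄ + u₀u₄² ≤ u₂²u₃`, and the two dropped terms
`4u₀u₃u₅ + u₁²u₅` are positive.  Companions: `…CensusNewtonS1.lean` (THEOREM L-N (b), the `s = 1` rungs),
`…CensusLaguerreL18.lean` (THEOREM L18-LAGUERRE(4), the bottom rung on every class-G support).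
APPENDED (engine-6 g16): `newton_s0_window_six` — the six-knot window `n = 6`, `e = (0, d₁, d₂, 2d₁, d₁+d₂, 2d₂)` made
UNCONDITIONAL by PROPOSITION κ* (`…CensusKappaStar.lean`): for naturals `d₁ < d₂ < 2d₁` with `5d₂² ≥ 5d₁d₂ + d₁²`
(`d₂/d₁ ≥ κ* ≈ 1.1708`) every Descartes-sharp 6-nomial on these knots has `Φ > 0` (helper `prod_univ_erase_eq_prod_ite`).
Nothing here bears on the Newton-bad supports, on `ζ_sym`, `DoorA26` / `DoorA34`, the crux, or `VP ≠ VNP`.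

[folklore] — the cell's own elementary theorem on top of the kernel C25 (`newton_cone_log`).
-/

-- `Summit.ValiantsHypothesis.ValiantsHypothesis.…` repeats a component by the D-0017 layout
-- (single-conjunct summit), which the `dupNamespace` linter flags; the name is mandated.
set_option linter.dupNamespace false

namespace Summit.ValiantsHypothesis.ValiantsHypothesis.Theorems.LacunarySymmetroidMatrixDescartes.Census

open Polynomial Finset
open scoped BigOperators Polynomial

set_option maxHeartbeats 400000 in
/-- **THEOREM L-N (a) (kernel): `M_W ≥ 0 ⟹ Φ > 0` on a Descartes-sharp window with the class-G gap shape.**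
For `Σ_{t<n} c_t X^{e_t}` (`e` strictly increasing, `n ≥ 6`, all `c_t ≠ 0`, at least `n − 1` distinct positive roots)
with `e₁ − e₀ = (e₂ − e₁) + (e₃ − e₂)`, `e₄ − e₃ = e₂ − e₁` and `π₀π₂π₃π₄ + π₁π₂²π₃ ≤ π₀π₁π₄²`
(`π_t = ∏_{u≠t}|e_t − e_u|`):  `0 < 4|c₀||c₃||c₅| + |c₁|²|c₅| + |c₂|²|c₃| − |c₀||c₄|² − |c₁||c₂||c₄|`.
(engine-1 g14 THEOREM L-N (a), READER PASS theory-2 g14.) [folklore] -/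
theorem newton_s0_window {n : ℕ} (hn : 6 ≤ n) (e : Fin n → ℕ) (he : StrictMono e) (c : Fin n → ℝ)
    (hc : ∀ t, c t ≠ 0)
    (hZ : n ≤ ((∑ t, C (c t) * X ^ (e t)).roots.toFinset.filter (fun x => 0 < x)).card + 1)
    (hgap1 : e ⟨1, by omega⟩ - e ⟨0, by omega⟩
        = (e ⟨2, by omega⟩ - e ⟨1, by omega⟩) + (e ⟨3, by omega⟩ - e ⟨2, by omega⟩))
    (hgap2 : e ⟨4, by omega⟩ - e ⟨3, by omega⟩ = e ⟨2, by omega⟩ - e ⟨1, by omega⟩)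
    (hM : (∏ u ∈ univ.erase (⟨0, by omega⟩ : Fin n), |((e ⟨0, by omega⟩ : ℕ) : ℝ) - e u|) *
            (∏ u ∈ univ.erase (⟨2, by omega⟩ : Fin n), |((e ⟨2, by omega⟩ : ℕ) : ℝ) - e u|) *
            (∏ u ∈ univ.erase (⟨3, by omega⟩ : Fin n), |((e ⟨3, by omega⟩ : ℕ) : ℝ) - e u|) *
            (∏ u ∈ univ.erase (⟨4, by omega⟩ : Fin n), |((e ⟨4, by omega⟩ : ℕ) : ℝ) - e u|)
          + (∏ u ∈ univ.erase (⟨1, by omega⟩ : Fin n), |((e ⟨1, by omega⟩ : ℕ) : ℝ) - e u|) *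
            (∏ u ∈ univ.erase (⟨2, by omega⟩ : Fin n), |((e ⟨2, by omega⟩ : ℕ) : ℝ) - e u|) ^ 2 *
            (∏ u ∈ univ.erase (⟨3, by omega⟩ : Fin n), |((e ⟨3, by omega⟩ : ℕ) : ℝ) - e u|)
          ≤ (∏ u ∈ univ.erase (⟨0, by omega⟩ : Fin n), |((e ⟨0, by omega⟩ : ℕ) : ℝ) - e u|) *
            (∏ u ∈ univ.erase (⟨1, by omega⟩ : Fin n), |((e ⟨1, by omega⟩ : ℕ) : ℝ) - e u|) *
            (∏ u ∈ univ.erase (⟨4, by omega⟩ : Fin n), |((e ⟨4, by omega⟩ : ℕ) : ℝ) - e u|) ^ 2) :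
    0 < 4 * |c ⟨0, by omega⟩| * |c ⟨3, by omega⟩| * |c ⟨5, by omega⟩| + |c ⟨1, by omega⟩| ^ 2 * |c ⟨5, by omega⟩|
        + |c ⟨2, by omega⟩| ^ 2 * |c ⟨3, by omega⟩| - |c ⟨0, by omega⟩| * |c ⟨4, by omega⟩| ^ 2
        - |c ⟨1, by omega⟩| * |c ⟨2, by omega⟩| * |c ⟨4, by omega⟩| := by
  set i0 : Fin n := ⟨0, by omega⟩ with hi0
  set i1 : Fin n := ⟨1, by omega⟩ with hi1
  set i2 : Fin n := ⟨2, by omega⟩ with hi2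
  set i3 : Fin n := ⟨3, by omega⟩ with hi3
  set i4 : Fin n := ⟨4, by omega⟩ with hi4
  set i5 : Fin n := ⟨5, by omega⟩ with hi5
  set π : Fin n → ℝ := fun t => ∏ u ∈ univ.erase t, |((e t : ℕ) : ℝ) - e u| with hπdef
  have hπpos : ∀ t, 0 < π t := by
    intro t
    refine Finset.prod_pos fun u hu => abs_pos.mpr (sub_ne_zero.mpr ?_)
    exact_mod_cast fun h => (Finset.mem_erase.mp hu).1 (he.injective h).symm
  have hupos : ∀ t, 0 < |c t| := fun t => abs_pos.mpr (hc t)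
  have hApos : ∀ t, 0 < |c t| * π t := fun t => mul_pos (hupos t) (hπpos t)
  have h01 : i0 < i1 := Fin.mk_lt_mk.mpr (by norm_num)
  have h12 : i1 < i2 := Fin.mk_lt_mk.mpr (by norm_num)
  have h23 : i2 < i3 := Fin.mk_lt_mk.mpr (by norm_num)
  have h34 : i3 < i4 := Fin.mk_lt_mk.mpr (by norm_num)
  have he01 : e i0 < e i1 := he h01
  have he12 : e i1 < e i2 := he h12
  have he23 : e i2 < e i3 := he h23
  have he34 : e i3 < e i4 := he h34
  -- gaps `δ = e₂−e₁ = e₄−e₃`, `γ = e₃−e₂`, `e₁−e₀ = γ+δ`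
  obtain ⟨δ, hδ⟩ : ∃ δ, e i2 = e i1 + δ := ⟨e i2 - e i1, by omega⟩
  obtain ⟨γ, hγ⟩ : ∃ γ, e i3 = e i2 + γ := ⟨e i3 - e i2, by omega⟩
  have hδ0 : 0 < δ := by omega
  have hγ0 : 0 < γ := by omega
  have hg1 : e i1 - e i0 = (e i2 - e i1) + (e i3 - e i2) := hgap1
  have hg2 : e i4 - e i3 = e i2 - e i1 := hgap2
  have he1 : e i1 = e i0 + (γ + δ) := by omega
  have he4 : e i4 = e i3 + δ := by omega
  -- the three Newton-cone inequalities in log form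
  have hN1 := newton_cone_log e he c hc hZ h01 h12
  have hN2 := newton_cone_log e he c hc hZ h12 h23
  have hN3 := newton_cone_log e he c hc hZ h23 h34
  set L0 := Real.log (|c i0| * π i0) with hL0
  set L1 := Real.log (|c i1| * π i1) with hL1
  set L2 := Real.log (|c i2| * π i2) with hL2
  set L3 := Real.log (|c i3| * π i3) with hL3
  set L4 := Real.log (|c i4| * π i4) with hL4
  change ((e i2 : ℝ) - e i1) * L0 + ((e i1 : ℝ) - e i0) * L2 ≤ ((e i2 : ℝ) - e i0) * L1 at hN1
  change ((e i3 : ℝ) - e i2) * L1 + ((e i2 : ℝ) - e i1) * L3 ≤ ((e i3 : ℝ) - e i1) * L2 at hN2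
  change ((e i4 : ℝ) - e i3) * L2 + ((e i3 : ℝ) - e i2) * L4 ≤ ((e i4 : ℝ) - e i2) * L3 at hN3
  -- rewrite the gaps as `γ`, `δ`
  have c1 : ((e i1 : ℕ) : ℝ) = (e i0 : ℝ) + γ + δ := by rw [he1]; push_cast; ring
  have c2 : ((e i2 : ℕ) : ℝ) = (e i0 : ℝ) + γ + 2 * δ := by rw [hδ, he1]; push_cast; ring
  have c3 : ((e i3 : ℕ) : ℝ) = (e i0 : ℝ) + 2 * γ + 2 * δ := by rw [hγ, hδ, he1]; push_cast; ring
  have c4 : ((e i4 : ℕ) : ℝ) = (e i0 : ℝ) + 2 * γ + 3 * δ := by rw [he4, hγ, hδ, he1]; push_cast; ring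
  rw [c1, c2] at hN1
  rw [c1, c2, c3] at hN2
  rw [c2, c3, c4] at hN3
  have hG : (0 : ℝ) < γ := by exact_mod_cast hγ0
  have hD : (0 : ℝ) < δ := by exact_mod_cast hδ0
  -- A: δ L0 + (γ+δ) L2 ≤ (γ+2δ) L1 ;  B: γ L1 + δ L3 ≤ (γ+δ) L2 ;  C: δ L2 + γ L4 ≤ (γ+δ) L3
  have hA : (δ : ℝ) * L0 + (γ + δ) * L2 ≤ (γ + 2 * δ) * L1 := by
    have := hN1; ring_nf at this ⊢; linarith
  have hB : (γ : ℝ) * L1 + δ * L3 ≤ (γ + δ) * L2 := by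
    have := hN2; ring_nf at this ⊢; linarith
  have hC : (δ : ℝ) * L2 + γ * L4 ≤ (γ + δ) * L3 := by
    have := hN3; ring_nf at this ⊢; linarith
  -- X: L1 + L4 ≤ L2 + L3
  have hX : L1 + L4 ≤ L2 + L3 := by
    have h : (γ : ℝ) * (L1 + L4) ≤ γ * (L2 + L3) := by linarith [hB, hC]
    exact le_of_mul_le_mul_left h hG
  -- Y: L0 + 2 L4 ≤ 2 L2 + L3
  have hY : L0 + 2 * L4 ≤ 2 * L2 + L3 := by
    have h1 := mul_le_mul_of_nonneg_left hA hG.le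
    have h2 := mul_le_mul_of_nonneg_left hB (by positivity : (0 : ℝ) ≤ γ + 2 * δ)
    have h3 := mul_le_mul_of_nonneg_left hC (by positivity : (0 : ℝ) ≤ 2 * δ)
    have h : (γ : ℝ) * δ * (L0 + 2 * L4) ≤ γ * δ * (2 * L2 + L3) := by
      have h1' := h1; have h2' := h2; have h3' := h3
      ring_nf at h1' h2' h3' ⊢
      linarith
    exact le_of_mul_le_mul_left h (mul_pos hG hD)
  -- exponentiate
  have eX : |c i1| * π i1 * (|c i4| * π i4) ≤ |c i2| * π i2 * (|c i3| * π i3) := by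
    have h := Real.exp_le_exp.mpr hX
    rwa [Real.exp_add, Real.exp_add, hL1, hL2, hL3, hL4, Real.exp_log (hApos i1), Real.exp_log (hApos i2),
      Real.exp_log (hApos i3), Real.exp_log (hApos i4)] at h
  have eY : |c i0| * π i0 * (|c i4| * π i4) ^ 2 ≤ (|c i2| * π i2) ^ 2 * (|c i3| * π i3) := by
    have h := Real.exp_le_exp.mpr hY
    rw [Real.exp_add, Real.exp_add, hL0, hL2, hL3, hL4, Real.exp_log (hApos i0), Real.exp_log (hApos i3)]
      at h
    have e2a : Real.exp (2 * Real.log (|c i4| * π i4)) = (|c i4| * π i4) ^ 2 := by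
      rw [show (2 : ℝ) * Real.log (|c i4| * π i4) = Real.log (|c i4| * π i4) + Real.log (|c i4| * π i4) by ring,
        Real.exp_add, Real.exp_log (hApos i4), sq]
    have e2b : Real.exp (2 * Real.log (|c i2| * π i2)) = (|c i2| * π i2) ^ 2 := by
      rw [show (2 : ℝ) * Real.log (|c i2| * π i2) = Real.log (|c i2| * π i2) + Real.log (|c i2| * π i2) by ring,
        Real.exp_add, Real.exp_log (hApos i2), sq]
    rwa [e2a, e2b] at h
  -- the final algebra with `M_W ≥ 0`
  have hM' : π i0 * π i2 * π i3 * π i4 + π i1 * π i2 ^ 2 * π i3 ≤ π i0 * π i1 * π i4 ^ 2 := hM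
  set u0 := |c i0|; set u1 := |c i1|; set u2 := |c i2|; set u3 := |c i3|; set u4 := |c i4|; set u5 := |c i5|
  set p0 := π i0; set p1 := π i1; set p2 := π i2; set p3 := π i3; set p4 := π i4
  have hp0 : 0 < p0 := hπpos i0
  have hp1 : 0 < p1 := hπpos i1
  have hp2 : 0 < p2 := hπpos i2
  have hp3 : 0 < p3 := hπpos i3
  have hp4 : 0 < p4 := hπpos i4
  have hu0 : 0 < u0 := hupos i0
  have hu1 : 0 < u1 := hupos i1
  have hu2 : 0 < u2 := hupos i2
  have hu3 : 0 < u3 := hupos i3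
  have hu4 : 0 < u4 := hupos i4
  have hu5 : 0 < u5 := hupos i5
  -- eX: u1 u4 p1 p4 ≤ u2 u3 p2 p3 ; eY: u0 u4² p0 p4² ≤ u2² u3 p2² p3
  have eX' : u1 * u4 * (p1 * p4) ≤ u2 * u3 * (p2 * p3) := by
    have := eX; ring_nf at this ⊢; linarith
  have eY' : u0 * u4 ^ 2 * (p0 * p4 ^ 2) ≤ u2 ^ 2 * u3 * (p2 ^ 2 * p3) := by
    have := eY; ring_nf at this ⊢; linarith
  -- key: (u1 u2 u4 + u0 u4²) · (p0 p1 p4²) ≤ u2² u3 · (p0 p1 p4²)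
  have hkey : (u1 * u2 * u4 + u0 * u4 ^ 2) * (p0 * p1 * p4 ^ 2) ≤ u2 ^ 2 * u3 * (p0 * p1 * p4 ^ 2) := by
    have t1 : u1 * u2 * u4 * (p0 * p1 * p4 ^ 2) ≤ u2 ^ 2 * u3 * (p0 * p2 * p3 * p4) := by
      have := mul_le_mul_of_nonneg_left eX' (by positivity : (0 : ℝ) ≤ u2 * p0 * p4)
      ring_nf at this ⊢; linarith
    have t2 : u0 * u4 ^ 2 * (p0 * p1 * p4 ^ 2) ≤ u2 ^ 2 * u3 * (p1 * p2 ^ 2 * p3) := by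
      have := mul_le_mul_of_nonneg_left eY' hp1.le
      ring_nf at this ⊢; linarith
    have t3 : u2 ^ 2 * u3 * (p0 * p2 * p3 * p4) + u2 ^ 2 * u3 * (p1 * p2 ^ 2 * p3)
        ≤ u2 ^ 2 * u3 * (p0 * p1 * p4 ^ 2) := by
      have := mul_le_mul_of_nonneg_left hM' (by positivity : (0 : ℝ) ≤ u2 ^ 2 * u3)
      ring_nf at this ⊢; linarith
    have hsum : u1 * u2 * u4 * (p0 * p1 * p4 ^ 2) + u0 * u4 ^ 2 * (p0 * p1 * p4 ^ 2)
        ≤ u2 ^ 2 * u3 * (p0 * p1 * p4 ^ 2) := by linarith [t1, t2, t3]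
    have eq1 : (u1 * u2 * u4 + u0 * u4 ^ 2) * (p0 * p1 * p4 ^ 2)
        = u1 * u2 * u4 * (p0 * p1 * p4 ^ 2) + u0 * u4 ^ 2 * (p0 * p1 * p4 ^ 2) := by ring
    rw [eq1]; exact hsum
  have hcore : u1 * u2 * u4 + u0 * u4 ^ 2 ≤ u2 ^ 2 * u3 :=
    le_of_mul_le_mul_right hkey (by positivity)
  linarith [hcore, mul_pos (mul_pos hu0 hu3) hu5, mul_pos (pow_pos hu1 2) hu5]

/-- Finite products over `univ.erase t` as full products with the `t`-factor replaced by `1`. -/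
theorem prod_univ_erase_eq_prod_ite {n : ℕ} (t : Fin n) (g : Fin n → ℝ) :
    ∏ u ∈ univ.erase t, g u = ∏ u, (if u = t then 1 else g u) := by
  rw [← Finset.prod_erase (s := univ) (f := fun u => if u = t then 1 else g u) (a := t) (by simp)]
  exact Finset.prod_congr rfl (fun u hu => by rw [if_neg (Finset.ne_of_mem_erase hu)])

set_option maxHeartbeats 400000 in
/-- **THEOREM L-N (a) on the six-knot class-G window, made unconditional by PROPOSITION κ*.**  For natural
numbers `d₁ < d₂ < 2d₁` with `5d₂² ≥ 5d₁d₂ + d₁²` (i.e. `d₂/d₁ ≥ κ* = (5+3√5)/10`; e.g. `d₂ = d₁ + 1` with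
`d₁ ≤ 5`), every Descartes-sharp real 6-nomial `Σ_{t<6} c_t X^{e_t}` on the knots
`e = (0, d₁, d₂, 2d₁, d₁+d₂, 2d₂)` (all `c_t ≠ 0`, at least `5` distinct positive roots) satisfies
`Φ = 4|c₀||c₃||c₅| + |c₁|²|c₅| + |c₂|²|c₃| − |c₀||c₄|² − |c₁||c₂||c₄| > 0`.
Proof: `newton_s0_window` at `n = 6` — the gap shape `e₁−e₀ = (e₂−e₁)+(e₃−e₂)`, `e₄−e₃ = e₂−e₁` holds on these
knots, and its Newton-good hypothesis `π₀π₂π₃π₄ + π₁π₂²π₃ ≤ π₀π₁π₄²` is `M^{low} ≥ 0`, which `kappaStar_identity`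
turns into `36 d₁⁸d₂⁵(d₂−d₁)⁵(5d₂²−5d₁d₂−d₁²) ≥ 0`.  (engine-1 g14's THEOREM L-N (a) + PROPOSITION κ*; a statement
about a HYPOTHETICAL sharp 6-nomial — nothing here bears on `ζ_sym`, the doors or the crux.) [folklore] -/
theorem newton_s0_window_six {d₁ d₂ : ℕ} (h12 : d₁ < d₂) (h21 : d₂ < 2 * d₁)
    (hκ : 5 * d₁ * d₂ + d₁ ^ 2 ≤ 5 * d₂ ^ 2) (c : Fin 6 → ℝ) (hc : ∀ t, c t ≠ 0)
    (hZ : 6 ≤ ((∑ t, C (c t) * X ^ ((![0, d₁, d₂, 2 * d₁, d₁ + d₂, 2 * d₂] : Fin 6 → ℕ) t)).roots.toFinset.filter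
      (fun x => 0 < x)).card + 1) :
    0 < 4 * |c 0| * |c 3| * |c 5| + |c 1| ^ 2 * |c 5| + |c 2| ^ 2 * |c 3| - |c 0| * |c 4| ^ 2
        - |c 1| * |c 2| * |c 4| := by
  set e : Fin 6 → ℕ := ![0, d₁, d₂, 2 * d₁, d₁ + d₂, 2 * d₂] with he_def
  have he0 : e 0 = 0 := rfl
  have he1 : e 1 = d₁ := rfl
  have he2 : e 2 = d₂ := rfl
  have he3 : e 3 = 2 * d₁ := rfl
  have he4 : e 4 = d₁ + d₂ := rfl
  have he5 : e 5 = 2 * d₂ := rfl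
  have hd1 : 0 < d₁ := by omega
  have he : StrictMono e := by
    refine Fin.strictMono_iff_lt_succ.mpr ?_
    intro i
    fin_cases i
    · show e 0 < e 1; rw [he0, he1]; omega
    · show e 1 < e 2; rw [he1, he2]; omega
    · show e 2 < e 3; rw [he2, he3]; omega
    · show e 3 < e 4; rw [he3, he4]; omega
    · show e 4 < e 5; rw [he4, he5]; omega
  -- real-cast facts
  have rd1 : (0 : ℝ) < d₁ := by exact_mod_cast hd1
  have rd12 : (d₁ : ℝ) < d₂ := by exact_mod_cast h12
  have rd21 : (d₂ : ℝ) < 2 * d₁ := by exact_mod_cast h21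
  have rκ : 5 * (d₁ : ℝ) * d₂ + (d₁ : ℝ) ^ 2 ≤ 5 * (d₂ : ℝ) ^ 2 := by exact_mod_cast hκ
  -- the twenty-five absolute differences of the knots (signs decided by `0 < d₁ < d₂ < 2d₁`)
  have a01 : |(0:ℝ) - d₁| = d₁ := by rw [abs_of_nonpos (by linarith)]; ring
  have a02 : |(0:ℝ) - d₂| = d₂ := by rw [abs_of_nonpos (by linarith)]; ring
  have a03 : |(0:ℝ) - 2 * d₁| = 2 * d₁ := by rw [abs_of_nonpos (by linarith)]; ring
  have a04 : |(0:ℝ) - (d₁ + d₂)| = d₁ + d₂ := by rw [abs_of_nonpos (by linarith)]; ring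
  have a05 : |(0:ℝ) - 2 * d₂| = 2 * d₂ := by rw [abs_of_nonpos (by linarith)]; ring
  have a10 : |(d₁:ℝ) - 0| = d₁ := by rw [abs_of_nonneg (by linarith)]; ring
  have a12 : |(d₁:ℝ) - d₂| = d₂ - d₁ := by rw [abs_of_nonpos (by linarith)]; ring
  have a13 : |(d₁:ℝ) - 2 * d₁| = d₁ := by rw [abs_of_nonpos (by linarith)]; ring
  have a14 : |(d₁:ℝ) - (d₁ + d₂)| = d₂ := by rw [abs_of_nonpos (by linarith)]; ring
  have a15 : |(d₁:ℝ) - 2 * d₂| = 2 * d₂ - d₁ := by rw [abs_of_nonpos (by linarith)]; ring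
  have a20 : |(d₂:ℝ) - 0| = d₂ := by rw [abs_of_nonneg (by linarith)]; ring
  have a21 : |(d₂:ℝ) - d₁| = d₂ - d₁ := by rw [abs_of_nonneg (by linarith)]
  have a23 : |(d₂:ℝ) - 2 * d₁| = 2 * d₁ - d₂ := by rw [abs_of_nonpos (by linarith)]; ring
  have a24 : |(d₂:ℝ) - (d₁ + d₂)| = d₁ := by rw [abs_of_nonpos (by linarith)]; ring
  have a25 : |(d₂:ℝ) - 2 * d₂| = d₂ := by rw [abs_of_nonpos (by linarith)]; ring
  have a30 : |2 * (d₁:ℝ) - 0| = 2 * d₁ := by rw [abs_of_nonneg (by linarith)]; ring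
  have a31 : |2 * (d₁:ℝ) - d₁| = d₁ := by rw [abs_of_nonneg (by linarith)]; ring
  have a32 : |2 * (d₁:ℝ) - d₂| = 2 * d₁ - d₂ := by rw [abs_of_nonneg (by linarith)]
  have a34 : |2 * (d₁:ℝ) - (d₁ + d₂)| = d₂ - d₁ := by rw [abs_of_nonpos (by linarith)]; ring
  have a35 : |2 * (d₁:ℝ) - 2 * d₂| = 2 * d₂ - 2 * d₁ := by rw [abs_of_nonpos (by linarith)]; ring
  have a40 : |(d₁:ℝ) + d₂ - 0| = d₁ + d₂ := by rw [abs_of_nonneg (by linarith)]; ring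
  have a41 : |(d₁:ℝ) + d₂ - d₁| = d₂ := by rw [abs_of_nonneg (by linarith)]; ring
  have a42 : |(d₁:ℝ) + d₂ - d₂| = d₁ := by rw [abs_of_nonneg (by linarith)]; ring
  have a43 : |(d₁:ℝ) + d₂ - 2 * d₁| = d₂ - d₁ := by rw [abs_of_nonneg (by linarith)]; ring
  have a45 : |(d₁:ℝ) + d₂ - 2 * d₂| = d₂ - d₁ := by rw [abs_of_nonpos (by linarith)]; ring
  -- the five weights `π_t = ∏_{u ≠ t} |e_t − e_u|`, evaluated
  have hπ0 : ∏ u ∈ univ.erase (0 : Fin 6), |((e 0 : ℕ) : ℝ) - e u|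
      = (d₁ : ℝ) * d₂ * (2 * d₁) * (d₁ + d₂) * (2 * d₂) := by
    rw [prod_univ_erase_eq_prod_ite, Fin.prod_univ_six]
    simp only [he0, he1, he2, he3, he4, he5, Fin.ext_iff, Fin.val_zero, Fin.val_one, Fin.val_two,
      show ((3 : Fin 6) : ℕ) = 3 from rfl, show ((4 : Fin 6) : ℕ) = 4 from rfl,
      show ((5 : Fin 6) : ℕ) = 5 from rfl]
    push_cast
    simp only [a01, a02, a03, a04, a05]
    norm_num
  have hπ1 : ∏ u ∈ univ.erase (1 : Fin 6), |((e 1 : ℕ) : ℝ) - e u|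
      = (d₁ : ℝ) * (d₂ - d₁) * d₁ * d₂ * (2 * d₂ - d₁) := by
    rw [prod_univ_erase_eq_prod_ite, Fin.prod_univ_six]
    simp only [he0, he1, he2, he3, he4, he5, Fin.ext_iff, Fin.val_zero, Fin.val_one, Fin.val_two,
      show ((3 : Fin 6) : ℕ) = 3 from rfl, show ((4 : Fin 6) : ℕ) = 4 from rfl,
      show ((5 : Fin 6) : ℕ) = 5 from rfl]
    push_cast
    simp only [a10, a12, a13, a14, a15]
    norm_num
  have hπ2 : ∏ u ∈ univ.erase (2 : Fin 6), |((e 2 : ℕ) : ℝ) - e u|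
      = (d₂ : ℝ) * (d₂ - d₁) * (2 * d₁ - d₂) * d₁ * d₂ := by
    rw [prod_univ_erase_eq_prod_ite, Fin.prod_univ_six]
    simp only [he0, he1, he2, he3, he4, he5, Fin.ext_iff, Fin.val_zero, Fin.val_one, Fin.val_two,
      show ((3 : Fin 6) : ℕ) = 3 from rfl, show ((4 : Fin 6) : ℕ) = 4 from rfl,
      show ((5 : Fin 6) : ℕ) = 5 from rfl]
    push_cast
    simp only [a20, a21, a23, a24, a25]
    norm_num
  have hπ3 : ∏ u ∈ univ.erase (3 : Fin 6), |((e 3 : ℕ) : ℝ) - e u|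
      = 2 * (d₁ : ℝ) * d₁ * (2 * d₁ - d₂) * (d₂ - d₁) * (2 * d₂ - 2 * d₁) := by
    rw [prod_univ_erase_eq_prod_ite, Fin.prod_univ_six]
    simp only [he0, he1, he2, he3, he4, he5, Fin.ext_iff, Fin.val_zero, Fin.val_one, Fin.val_two,
      show ((3 : Fin 6) : ℕ) = 3 from rfl, show ((4 : Fin 6) : ℕ) = 4 from rfl,
      show ((5 : Fin 6) : ℕ) = 5 from rfl]
    push_cast
    simp only [a30, a31, a32, a34, a35]
    norm_num
  have hπ4 : ∏ u ∈ univ.erase (4 : Fin 6), |((e 4 : ℕ) : ℝ) - e u|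
      = ((d₁ : ℝ) + d₂) * d₂ * d₁ * (d₂ - d₁) * (d₂ - d₁) := by
    rw [prod_univ_erase_eq_prod_ite, Fin.prod_univ_six]
    simp only [he0, he1, he2, he3, he4, he5, Fin.ext_iff, Fin.val_zero, Fin.val_one, Fin.val_two,
      show ((3 : Fin 6) : ℕ) = 3 from rfl, show ((4 : Fin 6) : ℕ) = 4 from rfl,
      show ((5 : Fin 6) : ℕ) = 5 from rfl]
    push_cast
    simp only [a40, a41, a42, a43, a45]
    norm_num
  -- PROPOSITION κ*: the Newton-good hypothesis of `newton_s0_window` holds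
  have hM : (∏ u ∈ univ.erase (0 : Fin 6), |((e 0 : ℕ) : ℝ) - e u|) *
        (∏ u ∈ univ.erase (2 : Fin 6), |((e 2 : ℕ) : ℝ) - e u|) *
        (∏ u ∈ univ.erase (3 : Fin 6), |((e 3 : ℕ) : ℝ) - e u|) *
        (∏ u ∈ univ.erase (4 : Fin 6), |((e 4 : ℕ) : ℝ) - e u|)
      + (∏ u ∈ univ.erase (1 : Fin 6), |((e 1 : ℕ) : ℝ) - e u|) *
        (∏ u ∈ univ.erase (2 : Fin 6), |((e 2 : ℕ) : ℝ) - e u|) ^ 2 *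
        (∏ u ∈ univ.erase (3 : Fin 6), |((e 3 : ℕ) : ℝ) - e u|)
      ≤ (∏ u ∈ univ.erase (0 : Fin 6), |((e 0 : ℕ) : ℝ) - e u|) *
        (∏ u ∈ univ.erase (1 : Fin 6), |((e 1 : ℕ) : ℝ) - e u|) *
        (∏ u ∈ univ.erase (4 : Fin 6), |((e 4 : ℕ) : ℝ) - e u|) ^ 2 := by
    rw [hπ0, hπ1, hπ2, hπ3, hπ4]
    have hid := kappaStar_identity (d₁ : ℝ) d₂
    have hnn := (kappaStar_nonneg_iff rd1 rd12).mpr (by linarith)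
    linarith [hid, hnn]
  have h := newton_s0_window (n := 6) le_rfl e he c hc hZ
    (by show d₁ - 0 = (d₂ - d₁) + (2 * d₁ - d₂); omega)
    (by show (d₁ + d₂) - 2 * d₁ = d₂ - d₁; omega) hM
  exact h

/-- **THEOREM L-N (a), «`M_W ≥ 0`» form.**  The same window theorem with the Newton condition written as the
non-negativity of the memo's integer `M_W(d) = π₀π₁π₄² − π₀π₂π₃π₄ − π₁π₂²π₃` (THEOREM-LN-E1G14.md §2(a)) — the
shape in which `Census.kappaStar_identity` (`…CensusKappaStar.lean`) evaluates it on the six low knots and in which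
the cell's scope tables are computed — rather than as the rearranged inequality of `newton_s0_window`.
(engine-1 g15; a repackaging, no new mathematics.) [folklore] -/
theorem newton_s0_window_of_nonneg {n : ℕ} (hn : 6 ≤ n) (e : Fin n → ℕ) (he : StrictMono e) (c : Fin n → ℝ)
    (hc : ∀ t, c t ≠ 0)
    (hZ : n ≤ ((∑ t, C (c t) * X ^ (e t)).roots.toFinset.filter (fun x => 0 < x)).card + 1)
    (hgap1 : e ⟨1, by omega⟩ - e ⟨0, by omega⟩
        = (e ⟨2, by omega⟩ - e ⟨1, by omega⟩) + (e ⟨3, by omega⟩ - e ⟨2, by omega⟩))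
    (hgap2 : e ⟨4, by omega⟩ - e ⟨3, by omega⟩ = e ⟨2, by omega⟩ - e ⟨1, by omega⟩)
    (hM : 0 ≤ (∏ u ∈ univ.erase (⟨0, by omega⟩ : Fin n), |((e ⟨0, by omega⟩ : ℕ) : ℝ) - e u|) *
            (∏ u ∈ univ.erase (⟨1, by omega⟩ : Fin n), |((e ⟨1, by omega⟩ : ℕ) : ℝ) - e u|) *
            (∏ u ∈ univ.erase (⟨4, by omega⟩ : Fin n), |((e ⟨4, by omega⟩ : ℕ) : ℝ) - e u|) ^ 2
          - (∏ u ∈ univ.erase (⟨0, by omega⟩ : Fin n), |((e ⟨0, by omega⟩ : ℕ) : ℝ) - e u|) *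
            (∏ u ∈ univ.erase (⟨2, by omega⟩ : Fin n), |((e ⟨2, by omega⟩ : ℕ) : ℝ) - e u|) *
            (∏ u ∈ univ.erase (⟨3, by omega⟩ : Fin n), |((e ⟨3, by omega⟩ : ℕ) : ℝ) - e u|) *
            (∏ u ∈ univ.erase (⟨4, by omega⟩ : Fin n), |((e ⟨4, by omega⟩ : ℕ) : ℝ) - e u|)
          - (∏ u ∈ univ.erase (⟨1, by omega⟩ : Fin n), |((e ⟨1, by omega⟩ : ℕ) : ℝ) - e u|) *
            (∏ u ∈ univ.erase (⟨2, by omega⟩ : Fin n), |((e ⟨2, by omega⟩ : ℕ) : ℝ) - e u|) ^ 2 *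
            (∏ u ∈ univ.erase (⟨3, by omega⟩ : Fin n), |((e ⟨3, by omega⟩ : ℕ) : ℝ) - e u|)) :
    0 < 4 * |c ⟨0, by omega⟩| * |c ⟨3, by omega⟩| * |c ⟨5, by omega⟩| + |c ⟨1, by omega⟩| ^ 2 * |c ⟨5, by omega⟩|
        + |c ⟨2, by omega⟩| ^ 2 * |c ⟨3, by omega⟩| - |c ⟨0, by omega⟩| * |c ⟨4, by omega⟩| ^ 2
        - |c ⟨1, by omega⟩| * |c ⟨2, by omega⟩| * |c ⟨4, by omega⟩| :=
  newton_s0_window hn e he c hc hZ hgap1 hgap2 (by linarith)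

end Summit.ValiantsHypothesis.ValiantsHypothesis.Theorems.LacunarySymmetroidMatrixDescartes.Census
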